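import Summits.Ventures.PercRepro.RankLevelSetLevelSevenRowThirtyEightChain
import Summits.Ventures.PercRepro.RankLevelSetLevelSevenRowThirtySeven

/-!
# PercRepro — THE ROW `37` OF LEVEL `7`: C-025 AT `q = 7` FOR EVERY FINITE MATROID AND EVERY `p ≥ 37`, ON THE
TELESCOPING COUNT WITH THE NULLITY SPLIT IN k STEPS, THE BONFERRONI CORRECTION AT LEVEL 7, THE SPLIT Y-TAIL, THE
(C3)-REFINED TRIANGLE COUNT `triBound8C`, p1's EXACT s₄ CHAIN / T4⁺, THE AVERAGING FIVE-CIRCUIT COUNT `702` AT `d = 8` AND THE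
GIANT-FLAT CASE SPLIT AT `d = 71 … 73` (p9, gen 29; S4 — the row `37` of the `q = 7` window: the top of the window moves
from `38` to `37`)

Each row from the row above and its own rank: `c025_seven_large_<word> (P ≤ p) : RLS M p 7` is `c025_seven_at_<word>`
(RankLevelSetLevelSevenRow<Word>) at `p = P` and the row `P + 1` above it; the row `38` is `c025_seven_large_thirty_eight`
(RankLevelSetLevelSevenRowThirtyEightChain, p8 g23). The chain reaches `37`; the literal `C025` body at `37`
(`c025_seven_thirty_seven`). Axioms: standard.
-/

open scoped Matroid

namespace PercRepro

namespace ThmN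

variable {α : Type}

/-- **THEOREM C₇ AT `37`, UNCONDITIONAL OVER THE TREE**: every finite matroid satisfies C-025 at level `7` for every
`p ≥ 37` — the row `37` by `c025_seven_at_thirty_seven`, the rows `≥ 38` by `c025_seven_large_thirty_eight`. -/
theorem c025_seven_large_thirty_seven (M : Matroid α) [M.Finite] (p : ℕ) (hp : 37 ≤ p) : RLS M p 7 := by
  rcases Nat.lt_or_ge p 38 with h | h
  · have h37 : p = 37 := by omega
    subst h37
    exact c025_seven_at_thirty_seven M
  · exact c025_seven_large_thirty_eight M p h

/-- The same in the literal `C025` body: `phiK p 7 · #U(p, 7) ≤ #Y(p, 7)` for every finite matroid and every `p ≥ 37`. -/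
theorem c025_seven_thirty_seven (M : Matroid α) [M.Finite] (p : ℕ) (hp : 37 ≤ p) :
    phiK p 7 * ({A : Set α | A ⊆ M.E ∧ M.eRk A = (p : ℕ∞) ∧ M.eRk (M.E \ A) = (7 : ℕ∞)}.ncard : ℚ) ≤
      ({A : Set α | A ⊆ M.E ∧ (7 : ℕ∞) < M.eRk A ∧ M.eRk A < (p : ℕ∞)}.ncard : ℚ) :=
  c025_seven_large_thirty_seven M p hp

end ThmN

end PercRepro
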